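import Mathlib
import Literature.Geometry.Kaehler.AnalyticSetComponentsProofs
import HarnessLib

/-!
# `C¹` submanifolds of `ℂⁿ` with complex tangent spaces are complex submanifolds

Stub `stub_isRegPt_of_contDiffOn_complexKer` of the crux `SuperThresholdRigidity` (item
stmt-HodgeConjecture-2737, line `registered`): the Cauchy–Riemann core of the recognition theorem
(King / Harvey–Shiffman, `C¹` case) in the complex model space. If a set `S ⊆ E ≅ ℂⁿ` is, on an
open `W ∋ a`, the zero set of a real `C¹` map `φ : E → ℝ^{2p}` whose differential is onto with
`i`-stable kernel at every point of `S ∩ W`, then near `a` the set `S` is the zero set of a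
HOLOMORPHIC submersion `g : E → ℂᵖ` (`Literature.Geometry.Kaehler.SCV.IsRegPt S p a`).

Proof ("a `C¹` graph with `ℂ`-linear differential is holomorphic"): `K = ker dφ(a)` is a complex
subspace; choose a complex complement `N`, so `dφ(a)|_N : N → ℝ^{2p}` is a real isomorphism and
`dim_ℂ N = p`. In the coordinates `E ≅ K × N` the real implicit function theorem writes `S` near `a`
as a graph `n = ψ(k)` of a `C¹` map `ψ`; differentiating `φ(k, ψ k) = 0` shows that the graph of
`dψ(k)` lies in the complex subspace `ker dφ(k, ψ k)`, which meets `N` trivially for `k` small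
(invertible operators are open), whence `dψ(k)` commutes with `i`, i.e. `ψ` is holomorphic near `0`
(`differentiableAt_iff_restrictScalars`). The holomorphic map `g(k, n) = e_N (n - ψ k)` with
`e_N : N ≃ ℂᵖ` cuts out `S` with onto differential.

References: Griffiths–Harris, *Principles of Algebraic Geometry* (1978), Ch. 0 §2; Chirka, *Complex
Analytic Sets* (1989), §2.3; Voisin, *Hodge Theory and Complex Algebraic Geometry I* (2002), §2.2.1.
-/

set_option linter.dupNamespace false

open Filter Topology Set

namespace Summit.HodgeConjecture.HodgeConjecture.Theorems

/-- A complex scalar acts through its real and imaginary parts: `c • v = re c • v + im c • (i • v)`.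
[folklore] -/
private theorem smul_eq_re_smul_add_im_smul_I {V : Type*} [AddCommGroup V] [Module ℂ V]
    (c : ℂ) (v : V) : c • v = c.re • v + c.im • (Complex.I • v) := by
  conv_lhs => rw [← Complex.re_add_im c]
  rw [add_smul, mul_smul, Complex.coe_smul, Complex.coe_smul]

/-- A real continuous linear map between complex normed spaces commuting with multiplication by `i`
is complex linear. [folklore] -/
private theorem exists_restrictScalars_eq_of_map_smul_I {V V' : Type*} [NormedAddCommGroup V]
    [NormedSpace ℂ V] [NormedAddCommGroup V'] [NormedSpace ℂ V'] (A : V →L[ℝ] V')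
    (h : ∀ v, A (Complex.I • v) = Complex.I • A v) :
    ∃ B : V →L[ℂ] V', B.restrictScalars ℝ = A := by
  let B : V →ₗ[ℂ] V' :=
    { toFun := A
      map_add' := fun x y => A.map_add x y
      map_smul' := fun c v => by
        simp only [RingHom.id_apply]
        rw [smul_eq_re_smul_add_im_smul_I c v, smul_eq_re_smul_add_im_smul_I c (A v), map_add,
          A.map_smul, A.map_smul, h] }
  exact ⟨⟨B, A.continuous⟩, by ext v; rfl⟩

/-- **Graphs inside complex subspaces are complex linear.** If the graph of a real linear
`A : K → N` lies in the kernel of `D`, the kernel of `D` is `i`-stable and `D` is injective on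
`0 × N`, then `A` commutes with `i`. [folklore] -/
private theorem map_smul_I_of_graph {K N Z : Type*} [NormedAddCommGroup K] [NormedSpace ℂ K]
    [NormedAddCommGroup N] [NormedSpace ℂ N] [NormedAddCommGroup Z] [NormedSpace ℝ Z]
    (D : K × N →L[ℝ] Z) (A : K →L[ℝ] N)
    (hgraph : ∀ k, D (k, A k) = 0) (hI : ∀ w, D w = 0 → D (Complex.I • w) = 0)
    (hinj : Function.Injective (D ∘L ContinuousLinearMap.inr ℝ K N)) (k : K) :
    A (Complex.I • k) = Complex.I • A k := by
  have h1 : D (Complex.I • k, A (Complex.I • k)) = 0 := hgraph _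
  have h2 : D (Complex.I • k, Complex.I • A k) = 0 := by
    have := hI _ (hgraph k)
    rwa [Prod.smul_mk] at this
  have h3 : (D ∘L ContinuousLinearMap.inr ℝ K N) (A (Complex.I • k) - Complex.I • A k) = 0 := by
    have e : ((0 : K), A (Complex.I • k) - Complex.I • A k) =
        (Complex.I • k, A (Complex.I • k)) - (Complex.I • k, Complex.I • A k) := by
      simp only [Prod.mk_sub_mk, sub_self]
    rw [ContinuousLinearMap.comp_apply, ContinuousLinearMap.inr_apply, e, map_sub, h1, h2, sub_zero]
  rw [← sub_eq_zero]
  exact hinj (h3.trans (map_zero _).symm)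

/-- **Differentiating an identity along a graph.** If `Φ (x, ψ x) = 0` near `k`, then
`dΦ(k, ψ k) (k', dψ(k) k') = 0` for all `k'`. [folklore] -/
private theorem fderiv_apply_graph_eq_zero {K N Z : Type*} [NormedAddCommGroup K]
    [NormedSpace ℝ K] [NormedAddCommGroup N] [NormedSpace ℝ N] [NormedAddCommGroup Z]
    [NormedSpace ℝ Z] {Φ : K × N → Z} {ψ : K → N} {k : K}
    (hΦ : DifferentiableAt ℝ Φ (k, ψ k)) (hψ : DifferentiableAt ℝ ψ k)
    (h0 : ∀ᶠ x in 𝓝 k, Φ (x, ψ x) = 0) (k' : K) :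
    fderiv ℝ Φ (k, ψ k) (k', fderiv ℝ ψ k k') = 0 := by
  have h1 : HasFDerivAt (fun x => Φ (x, ψ x))
      ((fderiv ℝ Φ (k, ψ k)).comp ((ContinuousLinearMap.id ℝ K).prod (fderiv ℝ ψ k))) k :=
    hΦ.hasFDerivAt.comp k ((hasFDerivAt_id k).prodMk hψ.hasFDerivAt)
  have h2 : HasFDerivAt (fun x => Φ (x, ψ x)) (0 : K →L[ℝ] Z) k :=
    (hasFDerivAt_const (0 : Z) k).congr_of_eventuallyEq h0
  have h3 := congrArg (fun T : K →L[ℝ] Z => T k') (h1.unique h2)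
  simpa using h3

/-- **Invertibility along a fixed subspace is open.** If `Φ` is `C¹` on an open `W ∋ u₀` and
`dΦ(u₀) ∘ T` is invertible, then `dΦ(u) ∘ T` is injective for `u` near `u₀`. [folklore] -/
private theorem eventually_injective_fderiv_comp {X Y Z : Type*} [NormedAddCommGroup X]
    [NormedSpace ℝ X] [CompleteSpace X] [NormedAddCommGroup Y] [NormedSpace ℝ Y]
    [NormedAddCommGroup Z] [NormedSpace ℝ Z] {Φ : Y → Z} {W : Set Y} {u₀ : Y}
    (hΦ : ContDiffOn ℝ 1 Φ W) (hW : IsOpen W) (hu₀ : u₀ ∈ W) (T : X →L[ℝ] Y)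
    (hinv : (fderiv ℝ Φ u₀ ∘L T).IsInvertible) :
    ∀ᶠ u in 𝓝 u₀, Function.Injective (fderiv ℝ Φ u ∘L T) := by
  have hcont : ContinuousAt (fun u => fderiv ℝ Φ u ∘L T) u₀ :=
    ((hΦ.continuousOn_fderiv_of_isOpen hW le_rfl).continuousAt (hW.mem_nhds hu₀)).clm_comp
      continuousAt_const
  obtain ⟨e, he⟩ := hinv
  have hmem : Set.range ((↑) : (X ≃L[ℝ] Z) → X →L[ℝ] Z) ∈ 𝓝 (fderiv ℝ Φ u₀ ∘L T) := by
    rw [← he]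
    exact e.nhds
  filter_upwards [hcont.eventually_mem hmem] with u hu
  obtain ⟨e', he'⟩ := hu
  rw [← he']
  exact e'.injective

/-- A bijective continuous linear map between Banach spaces is invertible (open mapping theorem).
[folklore] -/
private theorem isInvertible_of_bijective {X Z : Type*} [NormedAddCommGroup X] [NormedSpace ℝ X]
    [CompleteSpace X] [NormedAddCommGroup Z] [NormedSpace ℝ Z] [CompleteSpace Z] (T : X →L[ℝ] Z)
    (h : Function.Bijective T) : T.IsInvertible :=
  ⟨ContinuousLinearEquiv.ofBijective T (LinearMap.ker_eq_bot.2 h.1) (LinearMap.range_eq_top.2 h.2),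
    ContinuousLinearEquiv.coe_ofBijective _ _ _⟩

/-- **A complex complement of an `i`-stable kernel.** If `L : E → F` is a real linear surjection
whose kernel is stable under `i`, there are complementary complex subspaces `K` (the kernel) and
`N` of `E` with `L|_N : N → F` bijective. [folklore] -/
private theorem exists_isCompl_ker {E F : Type*} [NormedAddCommGroup E] [NormedSpace ℂ E]
    [FiniteDimensional ℂ E] [NormedAddCommGroup F] [NormedSpace ℝ F] (L : E →L[ℝ] F)
    (hsurj : Function.Surjective L) (hI : ∀ v, L v = 0 → L (Complex.I • v) = 0) :
    ∃ K N : Submodule ℂ E, IsCompl K N ∧ Function.Bijective (fun n : N => L n) := by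
  let K : Submodule ℂ E :=
    { carrier := {v | L v = 0}
      add_mem' := fun {v w} hv hw => by
        simp only [Set.mem_setOf_eq] at hv hw ⊢
        rw [map_add, hv, hw, add_zero]
      zero_mem' := by simp
      smul_mem' := fun c v hv => by
        simp only [Set.mem_setOf_eq] at hv ⊢
        rw [smul_eq_re_smul_add_im_smul_I, map_add, L.map_smul, L.map_smul, hv, hI v hv, smul_zero,
          smul_zero, add_zero] }
  have hK : ∀ v, v ∈ K ↔ L v = 0 := fun v => Iff.rfl
  obtain ⟨N, hKN⟩ := K.exists_isCompl
  refine ⟨K, N, hKN, ?_, ?_⟩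
  · intro n₁ n₂ h
    have h0 : L ((n₁ : E) - n₂) = 0 := by
      rw [map_sub]
      exact sub_eq_zero.2 h
    have hmemK : ((n₁ : E) - n₂) ∈ K := (hK _).2 h0
    have hmemN : ((n₁ : E) - n₂) ∈ N := N.sub_mem n₁.2 n₂.2
    have : ((n₁ : E) - n₂) = 0 := by
      have := Submodule.mem_inf.2 ⟨hmemK, hmemN⟩
      rwa [hKN.inf_eq_bot, Submodule.mem_bot] at this
    exact Subtype.ext (sub_eq_zero.1 this)
  · intro w
    obtain ⟨v, hv⟩ := hsurj w
    have hv' : v ∈ K ⊔ N := by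
      rw [hKN.sup_eq_top]
      trivial
    obtain ⟨k, hk, n, hn, rfl⟩ := Submodule.mem_sup.1 hv'
    refine ⟨⟨n, hn⟩, ?_⟩
    rw [map_add, (hK k).1 hk, zero_add] at hv
    exact hv

/-- `IsRegPt` is invariant under complex affine equivalences `u ↦ a + Ξ u`. [folklore] -/
private theorem isRegPt_of_comp_affine {E Ê : Type*} [NormedAddCommGroup E] [NormedSpace ℂ E]
    [NormedAddCommGroup Ê] [NormedSpace ℂ Ê] (Ξ : Ê ≃L[ℂ] E) (a : E) {S : Set E} {p : ℕ}
    (h : Literature.Geometry.Kaehler.SCV.IsRegPt ((fun u => a + Ξ u) ⁻¹' S) p 0) :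
    Literature.Geometry.Kaehler.SCV.IsRegPt S p a := by
  obtain ⟨U, hU, h0U, g, hg, hSU, hsurj⟩ := h
  set τ : E → Ê := fun z => Ξ.symm (z - a) with hτ
  have hτc : Continuous τ := Ξ.symm.continuous.comp (continuous_id.sub continuous_const)
  have hτa : τ a = 0 := by simp [hτ]
  have hAτ : ∀ z, a + Ξ (τ z) = z := fun z => by simp [hτ]
  have hτd : HasFDerivAt τ (Ξ.symm : E →L[ℂ] Ê) a := by
    have h1 : HasFDerivAt (fun z : E => z - a) (ContinuousLinearMap.id ℂ E) a :=
      (hasFDerivAt_id a).sub_const a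
    have h2 := ((Ξ.symm : E →L[ℂ] Ê).hasFDerivAt).comp a h1
    rwa [ContinuousLinearMap.comp_id] at h2
  refine ⟨τ ⁻¹' U, hU.preimage hτc, ?_, g ∘ τ, ?_, ?_, ?_⟩
  · show τ a ∈ U
    rw [hτa]
    exact h0U
  · exact hg.comp ((Ξ.symm : E →L[ℂ] Ê).differentiable.comp
      (differentiable_id.sub_const a)).differentiableOn (Set.mapsTo_preimage τ U)
  · ext z
    have key := Set.ext_iff.1 hSU (τ z)
    simp only [Set.mem_inter_iff, Set.mem_preimage, hAτ, Set.mem_singleton_iff] at key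
    simp only [Set.mem_inter_iff, Set.mem_preimage, Function.comp_apply, Set.mem_singleton_iff]
    exact key
  · have hg0 : HasFDerivAt g (fderiv ℂ g 0) (τ a) := by
      rw [hτa]
      exact (hg.differentiableAt (hU.mem_nhds h0U)).hasFDerivAt
    rw [(hg0.comp a hτd).fderiv]
    intro c
    obtain ⟨v, hv⟩ := hsurj c
    exact ⟨Ξ v, by simp [hv]⟩

/-- **Cauchy–Riemann along the graph.** In complex coordinates `K × N`: if `Φ` is real `C¹` on an
open `W ∋ 0` with `i`-stable `ker dΦ(u)` at its zeros, `∂_N Φ(0)` is invertible, and `ψ : K → N`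
is `C¹` at `0` with `ψ 0 = 0` and `Φ (k, ψ k) = 0` near `0`, then `ψ` is holomorphic near `0`:
the graph of `dψ(k)` lies in the complex subspace `ker dΦ(k, ψ k)`, which meets `N` trivially.
[cite: GriffithsHarrisPrinciples1978, Ch. 0 §2] -/
private theorem eventually_differentiableAt_complex {K N F : Type*}
    [NormedAddCommGroup K] [NormedSpace ℂ K] [FiniteDimensional ℂ K]
    [NormedAddCommGroup N] [NormedSpace ℂ N] [FiniteDimensional ℂ N]
    [NormedAddCommGroup F] [NormedSpace ℝ F]
    {W : Set (K × N)} {Φ : K × N → F} {ψ : K → N}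
    (hW : IsOpen W) (hΦ : ContDiffOn ℝ 1 Φ W) (h0W : (0 : K × N) ∈ W)
    (hI : ∀ u ∈ W, Φ u = 0 → ∀ w, fderiv ℝ Φ u w = 0 → fderiv ℝ Φ u (Complex.I • w) = 0)
    (hinv : (fderiv ℝ Φ 0 ∘L ContinuousLinearMap.inr ℝ K N).IsInvertible)
    (hψ : ContDiffAt ℝ 1 ψ 0) (hψ0 : ψ 0 = 0) (hev : ∀ᶠ k in 𝓝 (0 : K), Φ (k, ψ k) = 0) :
    ∀ᶠ k in 𝓝 (0 : K), DifferentiableAt ℂ ψ k := by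
  haveI : CompleteSpace N := FiniteDimensional.complete ℂ N
  -- the graph point `(k, ψ k)` tends to `0`
  have hγ : Tendsto (fun k : K => (k, ψ k)) (𝓝 0) (𝓝 0) := by
    have h := (continuousAt_id.prodMk hψ.continuousAt).tendsto
    simp only [id, hψ0, Prod.mk_zero_zero] at h
    exact h
  have e_W : ∀ᶠ k in 𝓝 (0 : K), (k, ψ k) ∈ W := hγ (hW.mem_nhds h0W)
  have e_cd : ∀ᶠ k in 𝓝 (0 : K), ContDiffAt ℝ 1 ψ k := hψ.eventually (by simp)
  have e_zero : ∀ᶠ k in 𝓝 (0 : K), ∀ᶠ x in 𝓝 k, Φ (x, ψ x) = 0 := hev.eventually_nhds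
  have e_inj : ∀ᶠ k in 𝓝 (0 : K),
      Function.Injective (fderiv ℝ Φ (k, ψ k) ∘L ContinuousLinearMap.inr ℝ K N) :=
    hγ.eventually (eventually_injective_fderiv_comp hΦ hW h0W _ hinv)
  filter_upwards [e_W, e_cd, e_zero, e_inj] with k hkW hkcd hk0 hkinj
  have hΦd : DifferentiableAt ℝ Φ (k, ψ k) :=
    (hΦ.contDiffAt (hW.mem_nhds hkW)).differentiableAt one_ne_zero
  have hψd : DifferentiableAt ℝ ψ k := hkcd.differentiableAt one_ne_zero
  have hgraph := fderiv_apply_graph_eq_zero hΦd hψd hk0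
  have hcomm := map_smul_I_of_graph (fderiv ℝ Φ (k, ψ k)) (fderiv ℝ ψ k) hgraph
    (hI _ hkW hk0.self_of_nhds) hkinj
  obtain ⟨B, hB⟩ := exists_restrictScalars_eq_of_map_smul_I (fderiv ℝ ψ k) hcomm
  exact (differentiableAt_iff_restrictScalars ℝ hψd).2 ⟨B, hB⟩

/-- **The coordinate form of the stub.** In complex coordinates `K × N` (finite-dimensional): if
`S ∩ W = W ∩ Φ⁻¹(0)` on an open `W ∋ 0` with `0 ∈ S`, `Φ : K × N → ℝ^{2p}` real `C¹` on `W` with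
`i`-stable `ker dΦ(u)` at the zeros of `Φ` in `W`, and `∂_N Φ(0)` invertible, then `0` is a regular
point of codimension `p` of `S`: by the real implicit function theorem `S` is near `0` the graph of
`ψ : K → N`, holomorphic near `0` (`eventually_differentiableAt_complex`), and
`g (k, n) = e_N (n - ψ k)` with `e_N : N ≃ ℂᵖ` (`dim_ℝ N = 2p`) is a holomorphic submersion cutting
out `S`. [cite: GriffithsHarrisPrinciples1978, Ch. 0 §2] [cite: Chirka1989, §2.3] -/
private theorem isRegPt_zero_of_prod {K N : Type*}
    [NormedAddCommGroup K] [NormedSpace ℂ K] [FiniteDimensional ℂ K]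
    [NormedAddCommGroup N] [NormedSpace ℂ N] [FiniteDimensional ℂ N] {p : ℕ}
    {S W : Set (K × N)} {Φ : K × N → (Fin (2 * p) → ℝ)}
    (hW : IsOpen W) (h0S : (0 : K × N) ∈ S) (h0W : (0 : K × N) ∈ W) (hΦ : ContDiffOn ℝ 1 Φ W)
    (hSW : S ∩ W = W ∩ Φ ⁻¹' {0})
    (hI : ∀ u ∈ W, Φ u = 0 → ∀ w, fderiv ℝ Φ u w = 0 → fderiv ℝ Φ u (Complex.I • w) = 0)
    (hinv : (fderiv ℝ Φ 0 ∘L ContinuousLinearMap.inr ℝ K N).IsInvertible) :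
    Literature.Geometry.Kaehler.SCV.IsRegPt S p 0 := by
  haveI : CompleteSpace K := FiniteDimensional.complete ℂ K
  haveI : CompleteSpace N := FiniteDimensional.complete ℂ N
  have hΦ0 : Φ 0 = 0 := by
    have : (0 : K × N) ∈ W ∩ Φ ⁻¹' {0} := hSW ▸ ⟨h0S, h0W⟩
    exact this.2
  have hcd : ContDiffAt ℝ 1 Φ 0 := hΦ.contDiffAt (hW.mem_nhds h0W)
  -- the real implicit function `ψ : K → N`
  set ψ : K → N := hcd.implicitFunction one_ne_zero hinv with hψdef
  have hψ0 : ψ 0 = 0 := hcd.implicitFunction_apply_self one_ne_zero hinv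
  have hev1 : ∀ᶠ k in 𝓝 (0 : K), Φ (k, ψ k) = 0 := by
    have := hcd.eventually_apply_implicitFunction one_ne_zero hinv
    rw [hΦ0] at this
    exact this
  have hev2 : ∀ᶠ v in 𝓝 (0 : K × N), Φ v = 0 ↔ ψ v.1 = v.2 := by
    have := hcd.eventually_apply_eq_iff_implicitFunction one_ne_zero hinv
    rw [hΦ0] at this
    exact this
  have hψcd : ContDiffAt ℝ 1 ψ 0 := hcd.contDiffAt_implicitFunction one_ne_zero hinv
  -- `ψ` is holomorphic near `0`
  have hhol : ∀ᶠ k in 𝓝 (0 : K), DifferentiableAt ℂ ψ k :=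
    eventually_differentiableAt_complex hW hΦ h0W hI hinv hψcd hψ0 hev1
  obtain ⟨O₁, hO₁, hO₁o, hO₁0⟩ := eventually_nhds_iff.1 hhol
  obtain ⟨O₂, hO₂, hO₂o, hO₂0⟩ := eventually_nhds_iff.1 (hev2.and (hW.mem_nhds h0W))
  -- `dim_ℂ N = p`
  obtain ⟨e, he⟩ := id hinv
  have hfin : Module.finrank ℂ N = Module.finrank ℂ (Fin p → ℂ) := by
    have h1 := e.toLinearEquiv.finrank_eq
    rw [Module.finrank_fin_fun, finrank_real_of_complex] at h1
    rw [Module.finrank_fin_fun]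
    omega
  let eN : N ≃L[ℂ] (Fin p → ℂ) := ContinuousLinearEquiv.ofFinrankEq hfin
  refine ⟨O₂ ∩ Prod.fst ⁻¹' O₁, hO₂o.inter (hO₁o.preimage continuous_fst), ⟨hO₂0, ?_⟩,
    fun v => eN (v.2 - ψ v.1), ?_, ?_, ?_⟩
  · simpa using hO₁0
  · intro v hv
    have h1 : DifferentiableAt ℂ ψ v.1 := hO₁ _ hv.2
    have h2 : DifferentiableAt ℂ (fun w : K × N => w.2 - ψ w.1) v :=
      differentiableAt_snd.sub (h1.comp v differentiableAt_fst)
    exact (eN.differentiableAt.comp v h2).differentiableWithinAt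
  · ext v
    simp only [Set.mem_inter_iff, Set.mem_preimage, Set.mem_singleton_iff]
    constructor
    · rintro ⟨hvS, hvO₂, hvO₁⟩
      obtain ⟨hiff, hvW⟩ := hO₂ v hvO₂
      have hΦv : Φ v = 0 := ((hSW ▸ ⟨hvS, hvW⟩ : v ∈ W ∩ Φ ⁻¹' {0})).2
      refine ⟨⟨hvO₂, hvO₁⟩, ?_⟩
      rw [hiff.1 hΦv, sub_self, map_zero]
    · rintro ⟨⟨hvO₂, hvO₁⟩, hv0⟩
      obtain ⟨hiff, hvW⟩ := hO₂ v hvO₂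
      rw [eN.map_eq_zero_iff, sub_eq_zero] at hv0
      have hΦv : Φ v = 0 := hiff.2 hv0.symm
      have : v ∈ S ∩ W := hSW.symm ▸ ⟨hvW, hΦv⟩
      exact ⟨this.1, hvO₂, hvO₁⟩
  · have hψd : HasFDerivAt ψ (fderiv ℂ ψ 0) (Prod.fst (0 : K × N)) := (hO₁ _ hO₁0).hasFDerivAt
    have h1 : HasFDerivAt (fun w : K × N => ψ w.1)
        ((fderiv ℂ ψ 0).comp (ContinuousLinearMap.fst ℂ K N)) 0 :=
      hψd.comp 0 hasFDerivAt_fst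
    have h2 : HasFDerivAt (fun w : K × N => w.2 - ψ w.1)
        (ContinuousLinearMap.snd ℂ K N - (fderiv ℂ ψ 0).comp (ContinuousLinearMap.fst ℂ K N)) 0 :=
      hasFDerivAt_snd.sub h1
    have h3 : HasFDerivAt (fun v : K × N => eN (v.2 - ψ v.1))
        ((eN : N →L[ℂ] (Fin p → ℂ)).comp (ContinuousLinearMap.snd ℂ K N -
          (fderiv ℂ ψ 0).comp (ContinuousLinearMap.fst ℂ K N))) 0 :=
      (eN : N →L[ℂ] (Fin p → ℂ)).hasFDerivAt.comp 0 h2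
    rw [h3.fderiv]
    intro t
    exact ⟨(0, eN.symm t), by simp⟩

/-- **Stub 2c (Cauchy–Riemann core: a `C¹` submanifold of `ℂⁿ` with complex tangent spaces is a
complex submanifold).** In a finite-dimensional complex normed space `E`: let `S ∩ W = W ∩ φ⁻¹(0)`
on an open `W ∋ a`, `a ∈ S`, with `φ : E → ℝ^{2p}` real `C¹` on `W`, and suppose that at every
point `y ∈ S ∩ W` the differential `dφ(y)` is onto and its kernel is stable under multiplication by
`i`. Then `a` is a regular point of complex codimension `p` of `S`: near `a`, `S` is the zero set of
a holomorphic submersion onto `ℂᵖ`. Proof: `K = ker dφ(a)` is a complex subspace with a complex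
complement `N` on which `dφ(a)` is a real isomorphism onto `ℝ^{2p}` (`exists_isCompl_ker`); in the
coordinates `E ≅ K × N` apply `isRegPt_zero_of_prod` and transport back
(`isRegPt_of_comp_affine`). [cite: GriffithsHarrisPrinciples1978, Ch. 0 §2] [cite: Chirka1989, §2.3]
[cite: VoisinHodgeI2002, §2.2.1] -/
theorem stub_isRegPt_of_contDiffOn_complexKer : ∀ {E : Type*} [NormedAddCommGroup E] [NormedSpace ℂ E] [FiniteDimensional ℂ E] {p : ℕ} {S W : Set E} {a : E} {φ : E → (Fin (2 * p) → ℝ)}, IsOpen W → a ∈ S → a ∈ W → ContDiffOn ℝ 1 φ W → S ∩ W = W ∩ φ ⁻¹' {0} → (∀ y ∈ S ∩ W, Function.Surjective (fderiv ℝ φ y) ∧ ∀ v : E, fderiv ℝ φ y v = 0 → fderiv ℝ φ y (Complex.I • v) = 0) → Literature.Geometry.Kaehler.SCV.IsRegPt S p a := by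
  intro E _ _ _ p S W a φ hW haS haW hφ hSW hreg
  obtain ⟨hLsurj, hLI⟩ := hreg a ⟨haS, haW⟩
  obtain ⟨K, N, hKN, hbij⟩ := exists_isCompl_ker (fderiv ℝ φ a) hLsurj hLI
  haveI : CompleteSpace N := FiniteDimensional.complete ℂ N
  let Ξ : (K × N) ≃L[ℂ] E := (Submodule.prodEquivOfIsCompl K N hKN).toContinuousLinearEquiv
  have hΞ : ∀ u : K × N, Ξ u = (u.1 : E) + (u.2 : E) := fun u => rfl
  let Ξr : (K × N) →L[ℝ] E := (Ξ : (K × N) →L[ℂ] E).restrictScalars ℝ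
  have hΞr : ∀ w, Ξr w = Ξ w := fun _ => rfl
  set A : K × N → E := fun u => a + Ξ u with hA
  have hAd : ∀ u, HasFDerivAt A Ξr u := fun u =>
    ((Ξ : (K × N) →L[ℂ] E).hasFDerivAt.restrictScalars ℝ).const_add a
  have hAc : Continuous A := continuous_const.add Ξ.continuous
  have hA0 : A 0 = a := by simp [hA]
  have hAcd : ContDiff ℝ 1 A := contDiff_const.add Ξr.contDiff
  have hW' : IsOpen (A ⁻¹' W) := hW.preimage hAc
  have h0W : (0 : K × N) ∈ A ⁻¹' W := by
    show A 0 ∈ W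
    rw [hA0]
    exact haW
  have h0S : (0 : K × N) ∈ A ⁻¹' S := by
    show A 0 ∈ S
    rw [hA0]
    exact haS
  have hΦ : ContDiffOn ℝ 1 (φ ∘ A) (A ⁻¹' W) := hφ.comp hAcd.contDiffOn (Set.mapsTo_preimage A W)
  have hSW' : A ⁻¹' S ∩ A ⁻¹' W = A ⁻¹' W ∩ (φ ∘ A) ⁻¹' {0} := by
    rw [← Set.preimage_inter, hSW, Set.preimage_inter, Set.preimage_comp]
  -- the differential of `φ ∘ A`
  have hderiv : ∀ u ∈ A ⁻¹' W, HasFDerivAt (φ ∘ A) ((fderiv ℝ φ (A u)).comp Ξr) u :=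
    fun u hu => ((hφ.contDiffAt (hW.mem_nhds hu)).differentiableAt one_ne_zero).hasFDerivAt.comp
      u (hAd u)
  have hI : ∀ u ∈ A ⁻¹' W, (φ ∘ A) u = 0 → ∀ w, fderiv ℝ (φ ∘ A) u w = 0 →
      fderiv ℝ (φ ∘ A) u (Complex.I • w) = 0 := by
    intro u hu hu0 w hw
    have hmem : A u ∈ S ∩ W := by
      rw [hSW]
      exact ⟨hu, hu0⟩
    rw [(hderiv u hu).fderiv] at hw ⊢
    simp only [ContinuousLinearMap.comp_apply, hΞr] at hw ⊢
    rw [Ξ.map_smul]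
    exact (hreg _ hmem).2 _ hw
  have hinv : (fderiv ℝ (φ ∘ A) 0 ∘L ContinuousLinearMap.inr ℝ K N).IsInvertible := by
    rw [(hderiv 0 h0W).fderiv]
    have heq : (((fderiv ℝ φ (A 0)).comp Ξr ∘L ContinuousLinearMap.inr ℝ K N :
        N →L[ℝ] (Fin (2 * p) → ℝ)) : N → (Fin (2 * p) → ℝ)) = fun n : N => fderiv ℝ φ a n := by
      funext n
      simp only [ContinuousLinearMap.comp_apply, ContinuousLinearMap.inr_apply, hΞr, hA0, hΞ,
        ZeroMemClass.coe_zero, zero_add]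
    refine isInvertible_of_bijective _ ?_
    rw [heq]
    exact hbij
  exact isRegPt_of_comp_affine Ξ a (isRegPt_zero_of_prod hW' h0S h0W hΦ hSW' hI hinv)

end Summit.HodgeConjecture.HodgeConjecture.Theorems
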